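import Summits.ValiantsHypothesis.ValiantsHypothesis.Theorems.KPlusLogSqLawStaticPathLowTips

/-!
# Route «KPlusLogSqLaw» — parametric max-weight independent set on a path: THEOREM T′, the λ-low tips — no bad line at the top candidate (three types)

HONEST FRAMING.  Helper toward the crux `WeakLifting` (item `stmt-ValiantsHypothesis-19561`, route `KPlusLogSqLaw`, cell `pub-symmetroid`,
seat val-sym-lift-p4 g21, 2026-08-29) on the line of its witness-plan stub `stub_tridiagonalSectorB` (tropical twin of the STATIC tridiagonal
sector = parametric maximum-weight independent set on a path).  Second file of the λ-low-tip geometry of THEOREM T′ (THEOREM-T.md §4; first file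
`…StaticPathLowTips`): the three one-step lemmas behind the existence of the λ-low tip.  At the vertex of a λ-type pair — (I) two floors whose
slopes straddle `λ`, (II) a ceiling and a flatter floor of slope `> λ`, (III) a flatter ceiling and a floor of slope `< λ` — suppose every λ-type
pair formed from the pair's lines and a third line `t` has functional value `y - λθ` at most the pair's, and some point is weakly on the correct
side of the pair's lines and of `t`; then `t` is not strictly incorrect at the vertex (`noBad_typeI/II/III`): an incorrect `t` either forms, with one
of the two lines, a λ-type pair of LARGER functional value, or makes the three weak half-planes inconsistent.  Sign algebra only (the crossing
lemmas of `…StaticPathMixedEventsTips`).  Statements about a labelled line arrangement; nothing here asserts anything about `WeakLifting`,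
`TropicalB`, `KPlusLogSqLaw`, the stub in its window, `MatrixDescartes` (stmt-ValiantsHypothesis-18050) or `VP ≠ VNP`.
-/

set_option linter.dupNamespace false
set_option autoImplicit false

namespace Summit.ValiantsHypothesis.ValiantsHypothesis.Theorems.KPlusLogSqLaw

open Finset Classical

namespace StaticPathFold

noncomputable section

variable (a b : ℕ → ℝ)

section LowTips

variable (lam : ℝ) (S : ℕ → ℕ → Prop)

/-! ## 3. No bad line at the candidate of largest functional value: the three types -/

/-- the functional along one line: `(L ℓ θ₁ - λ θ₁) - (L ℓ θ₀ - λ θ₀) = (a ℓ - λ)(θ₁ - θ₀)`. [folklore] -/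
theorem phi_along (ℓ : ℕ) (θ₀ θ₁ : ℝ) :
    (L a b ℓ θ₁ - lam * θ₁) - (L a b ℓ θ₀ - lam * θ₀) = (a ℓ - lam) * (θ₁ - θ₀) := by
  unfold L; ring

/-- type I step: at the vertex of two floors `o₁, o₂` whose slopes straddle `λ`, if every λ-type pair among `t, o₁, o₂` has functional value at
most that of `(o₁, o₂)` and some point is weakly correct for `o₁, o₂, t`, then `t` is not strictly incorrect at the vertex. [folklore] -/
theorem noBad_typeI
    (hS : ∀ p q, S p q ↔
      ((¬ Even p ∧ ¬ Even q ∧ ((a p < lam ∧ lam < a q) ∨ (a q < lam ∧ lam < a p))) ∨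
       (Odd (p + q) ∧ (if Even p then a q < a p else a p < a q) ∧ lam < (if Even p then a q else a p)) ∨
       (Odd (p + q) ∧ (if Even p then a p < a q else a q < a p) ∧ (if Even p then a q else a p) < lam)))
    {o₁ o₂ t : ℕ} (ho₁ : ¬ Even o₁) (ho₂ : ¬ Even o₂) (h1 : a o₁ < lam) (h2 : lam < a o₂)
    (hAt₁ : a t ≠ a o₁) (hAt₂ : a t ≠ a o₂) (hlt : a t ≠ lam)
    (hbad : (Even t ∧ L a b t ((b o₂ - b o₁) / (a o₁ - a o₂)) < L a b o₁ ((b o₂ - b o₁) / (a o₁ - a o₂))) ∨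
      (¬ Even t ∧ L a b o₁ ((b o₂ - b o₁) / (a o₁ - a o₂)) < L a b t ((b o₂ - b o₁) / (a o₁ - a o₂))))
    (hmax : ∀ x y, (x = t ∨ x = o₁ ∨ x = o₂) → (y = t ∨ y = o₁ ∨ y = o₂) → S x y →
      L a b x ((b y - b x) / (a x - a y)) - lam * ((b y - b x) / (a x - a y)) ≤
        L a b o₁ ((b o₂ - b o₁) / (a o₁ - a o₂)) - lam * ((b o₂ - b o₁) / (a o₁ - a o₂)))
    (hwit : ∃ θ' y', L a b o₁ θ' ≤ y' ∧ L a b o₂ θ' ≤ y' ∧ (Even t → y' ≤ L a b t θ') ∧ (¬ Even t → L a b t θ' ≤ y')) :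
    False := by
  set τ₀ := (b o₂ - b o₁) / (a o₁ - a o₂) with hτ₀
  have hA : a o₁ ≠ a o₂ := ne_of_lt (h1.trans h2)
  have hy : L a b o₂ τ₀ = L a b o₁ τ₀ := L_eq_L_crossAbs a b hA
  rcases hbad with ⟨hte, hb⟩ | ⟨hto, hb⟩
  · -- a ceiling below the vertex
    rcases lt_or_gt_of_ne hAt₂ with hlt₂ | hgt₂
    · rcases lt_or_gt_of_ne hAt₁ with hlt₁ | hgt₁
      · -- flatter than `o₁`: the right tip `(t, o₁)` is a better candidate
        have hSt : S t o₁ := (hS t o₁).mpr (Or.inr (Or.inr ⟨by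
          rw [Nat.odd_add']; exact ⟨fun _ => hte, fun _ => Nat.not_even_iff_odd.mp ho₁⟩,
          by rw [if_pos hte]; exact hlt₁, by rw [if_pos hte]; exact h1⟩))
        have hm := hmax t o₁ (Or.inl rfl) (Or.inr (Or.inl rfl)) hSt
        -- its vertex lies on `o₁`, to the left of `τ₀`
        have hcr : (b o₁ - b t) / (a t - a o₁) < τ₀ := (L_lt_L_iff_crossAbs_lt a b hlt₁ τ₀).mp hb
        have e1 : L a b t ((b o₁ - b t) / (a t - a o₁)) = L a b o₁ ((b o₁ - b t) / (a t - a o₁)) :=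
          (L_eq_L_crossAbs a b (ne_of_lt hlt₁)).symm
        rw [e1] at hm
        have e2 := phi_along a b lam o₁ τ₀ ((b o₁ - b t) / (a t - a o₁))
        have : 0 < (a o₁ - lam) * ((b o₁ - b t) / (a t - a o₁) - τ₀) := mul_pos_of_neg_of_neg (by linarith) (by linarith)
        linarith
      · -- slope strictly between: no point is weakly correct for `o₁, o₂, t`
        obtain ⟨θ', y', c1, c2, c3, -⟩ := hwit
        have c3' := c3 hte
        have f1 := L_eq_L_add_mul a b o₁ τ₀ θ'
        have f2 := L_eq_L_add_mul a b o₂ τ₀ θ'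
        have f3 := L_eq_L_add_mul a b t τ₀ θ'
        rcases le_or_gt τ₀ θ' with hθ | hθ
        · nlinarith [mul_nonneg (sub_nonneg.mpr hlt₂.le) (sub_nonneg.mpr hθ)]
        · nlinarith [mul_nonneg_of_nonpos_of_nonpos (sub_nonpos.mpr hgt₁.le) (sub_nonpos.mpr hθ.le)]
    · -- steeper than `o₂`: the left tip `(t, o₂)` is a better candidate
      have hSt : S t o₂ := (hS t o₂).mpr (Or.inr (Or.inl ⟨by
        rw [Nat.odd_add']; exact ⟨fun _ => hte, fun _ => Nat.not_even_iff_odd.mp ho₂⟩,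
        by rw [if_pos hte]; exact hgt₂, by rw [if_pos hte]; exact h2⟩))
      have hm := hmax t o₂ (Or.inl rfl) (Or.inr (Or.inr rfl)) hSt
      have hcr : τ₀ < (b t - b o₂) / (a o₂ - a t) := (L_lt_L_iff_lt_crossAbs a b hgt₂ τ₀).mp (by rw [hy]; exact hb)
      have e0 : (b o₂ - b t) / (a t - a o₂) = (b t - b o₂) / (a o₂ - a t) := crossAbs_symm a b t o₂
      have e1 : L a b t ((b o₂ - b t) / (a t - a o₂)) = L a b o₂ ((b o₂ - b t) / (a t - a o₂)) :=
        (L_eq_L_crossAbs a b (ne_of_gt hgt₂)).symm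
      rw [e1, e0] at hm
      have e2 := phi_along a b lam o₂ τ₀ ((b t - b o₂) / (a o₂ - a t))
      have : 0 < (a o₂ - lam) * ((b t - b o₂) / (a o₂ - a t) - τ₀) := mul_pos (by linarith) (by linarith)
      linarith
  · -- a floor above the vertex
    rcases lt_or_gt_of_ne hlt with hl | hg
    · -- flatter than `λ`: the bottom corner `(t, o₂)` is a better candidate
      have hSt : S t o₂ := (hS t o₂).mpr (Or.inl ⟨hto, ho₂, Or.inl ⟨hl, h2⟩⟩)
      have hm := hmax t o₂ (Or.inl rfl) (Or.inr (Or.inr rfl)) hSt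
      have hlt₂ : a t < a o₂ := hl.trans h2
      have hcr : τ₀ < (b o₂ - b t) / (a t - a o₂) := (L_lt_L_iff_lt_crossAbs a b hlt₂ τ₀).mp (by rw [hy]; exact hb)
      have e1 : L a b t ((b o₂ - b t) / (a t - a o₂)) = L a b o₂ ((b o₂ - b t) / (a t - a o₂)) :=
        (L_eq_L_crossAbs a b (ne_of_lt hlt₂)).symm
      rw [e1] at hm
      have e2 := phi_along a b lam o₂ τ₀ ((b o₂ - b t) / (a t - a o₂))
      have : 0 < (a o₂ - lam) * ((b o₂ - b t) / (a t - a o₂) - τ₀) := mul_pos (by linarith) (by linarith)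
      linarith
    · -- steeper than `λ`: the bottom corner `(o₁, t)` is a better candidate
      have hSt : S o₁ t := (hS o₁ t).mpr (Or.inl ⟨ho₁, hto, Or.inl ⟨h1, hg⟩⟩)
      have hm := hmax o₁ t (Or.inr (Or.inl rfl)) (Or.inl rfl) hSt
      have hlt₁ : a o₁ < a t := h1.trans hg
      have hcr : (b t - b o₁) / (a o₁ - a t) < τ₀ := (L_lt_L_iff_crossAbs_lt a b hlt₁ τ₀).mp hb
      have e2 := phi_along a b lam o₁ τ₀ ((b t - b o₁) / (a o₁ - a t))
      have : 0 < (a o₁ - lam) * ((b t - b o₁) / (a o₁ - a t) - τ₀) := mul_pos_of_neg_of_neg (by linarith) (by linarith)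
      linarith

/-- type II step: at the vertex of a ceiling `e` and a flatter floor `o` of slope `> λ` (a left tip), if every λ-type pair among `t, e, o` has
functional value at most that of `(e, o)` and some point is weakly correct for `e, o, t`, then `t` is not strictly incorrect at the vertex. [folklore] -/
theorem noBad_typeII
    (hS : ∀ p q, S p q ↔
      ((¬ Even p ∧ ¬ Even q ∧ ((a p < lam ∧ lam < a q) ∨ (a q < lam ∧ lam < a p))) ∨
       (Odd (p + q) ∧ (if Even p then a q < a p else a p < a q) ∧ lam < (if Even p then a q else a p)) ∨
       (Odd (p + q) ∧ (if Even p then a p < a q else a q < a p) ∧ (if Even p then a q else a p) < lam)))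
    {e o t : ℕ} (he : Even e) (ho : ¬ Even o) (hs : a o < a e) (hl : lam < a o)
    (hAte : a t ≠ a e) (hAto : a t ≠ a o) (hlt : a t ≠ lam)
    (hbad : (Even t ∧ L a b t ((b o - b e) / (a e - a o)) < L a b o ((b o - b e) / (a e - a o))) ∨
      (¬ Even t ∧ L a b o ((b o - b e) / (a e - a o)) < L a b t ((b o - b e) / (a e - a o))))
    (hmax : ∀ x y, (x = t ∨ x = e ∨ x = o) → (y = t ∨ y = e ∨ y = o) → S x y →
      L a b x ((b y - b x) / (a x - a y)) - lam * ((b y - b x) / (a x - a y)) ≤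
        L a b o ((b o - b e) / (a e - a o)) - lam * ((b o - b e) / (a e - a o)))
    (hwit : ∃ θ' y', y' ≤ L a b e θ' ∧ L a b o θ' ≤ y' ∧ (Even t → y' ≤ L a b t θ') ∧ (¬ Even t → L a b t θ' ≤ y')) :
    False := by
  set τ₀ := (b o - b e) / (a e - a o) with hτ₀
  have hA : a e ≠ a o := ne_of_gt hs
  have hy : L a b o τ₀ = L a b e τ₀ := L_eq_L_crossAbs a b hA
  have hτ₀' : τ₀ = (b e - b o) / (a o - a e) := by rw [hτ₀]; exact crossAbs_symm a b e o
  rcases hbad with ⟨hte, hb⟩ | ⟨hto, hb⟩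
  · -- a ceiling below the vertex
    rcases lt_or_gt_of_ne hAto with hlt' | hgt'
    · -- flatter than the floor: no point is weakly correct for `e, o, t`
      obtain ⟨θ', y', c1, c2, c3, -⟩ := hwit
      have c3' := c3 hte
      have hθ : τ₀ ≤ θ' := by rw [hτ₀']; exact (L_le_L_iff_crossAbs_le a b hs θ').mp (c2.trans c1)
      have f2 := L_eq_L_add_mul a b o τ₀ θ'
      have f3 := L_eq_L_add_mul a b t τ₀ θ'
      nlinarith [mul_nonneg (sub_nonneg.mpr hlt'.le) (sub_nonneg.mpr hθ)]
    · -- steeper than the floor: the left tip `(t, o)` is a better candidate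
      have hSt : S t o := (hS t o).mpr (Or.inr (Or.inl ⟨by
        rw [Nat.odd_add']; exact ⟨fun _ => hte, fun _ => Nat.not_even_iff_odd.mp ho⟩,
        by rw [if_pos hte]; exact hgt', by rw [if_pos hte]; exact hl⟩))
      have hm := hmax t o (Or.inl rfl) (Or.inr (Or.inr rfl)) hSt
      have hcr : τ₀ < (b t - b o) / (a o - a t) := (L_lt_L_iff_lt_crossAbs a b hgt' τ₀).mp hb
      have e0 : (b o - b t) / (a t - a o) = (b t - b o) / (a o - a t) := crossAbs_symm a b t o
      have e1 : L a b t ((b o - b t) / (a t - a o)) = L a b o ((b o - b t) / (a t - a o)) :=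
        (L_eq_L_crossAbs a b (ne_of_gt hgt')).symm
      rw [e1, e0] at hm
      have e2 := phi_along a b lam o τ₀ ((b t - b o) / (a o - a t))
      have : 0 < (a o - lam) * ((b t - b o) / (a o - a t) - τ₀) := mul_pos (by linarith) (by linarith)
      linarith
  · -- a floor above the vertex
    rcases lt_or_gt_of_ne hAte with hlt' | hgt'
    · rcases lt_or_gt_of_ne hlt with hl' | hg'
      · -- flatter than `λ`: the bottom corner `(t, o)` is a better candidate
        have hSt : S t o := (hS t o).mpr (Or.inl ⟨hto, ho, Or.inl ⟨hl', hl⟩⟩)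
        have hm := hmax t o (Or.inl rfl) (Or.inr (Or.inr rfl)) hSt
        have hto' : a t < a o := hl'.trans hl
        have hcr : τ₀ < (b o - b t) / (a t - a o) := (L_lt_L_iff_lt_crossAbs a b hto' τ₀).mp hb
        have e1 : L a b t ((b o - b t) / (a t - a o)) = L a b o ((b o - b t) / (a t - a o)) :=
          (L_eq_L_crossAbs a b (ne_of_lt hto')).symm
        rw [e1] at hm
        have e2 := phi_along a b lam o τ₀ ((b o - b t) / (a t - a o))
        have : 0 < (a o - lam) * ((b o - b t) / (a t - a o) - τ₀) := mul_pos (by linarith) (by linarith)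
        linarith
      · -- slope between `λ` and the ceiling's: the left tip `(e, t)` is a better candidate
        have hSt : S e t := (hS e t).mpr (Or.inr (Or.inl ⟨by
          rw [Nat.odd_add]; exact ⟨fun h => absurd he (Nat.not_even_iff_odd.mpr h), fun h => absurd h hto⟩,
          by rw [if_pos he]; exact hlt', by rw [if_pos he]; exact hg'⟩))
        have hm := hmax e t (Or.inr (Or.inl rfl)) (Or.inl rfl) hSt
        have hcr : τ₀ < (b e - b t) / (a t - a e) := (L_lt_L_iff_lt_crossAbs a b hlt' τ₀).mp (by rw [← hy]; exact hb)
        have e0 : (b t - b e) / (a e - a t) = (b e - b t) / (a t - a e) := crossAbs_symm a b e t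
        rw [e0] at hm
        have e2 := phi_along a b lam e τ₀ ((b e - b t) / (a t - a e))
        have : 0 < (a e - lam) * ((b e - b t) / (a t - a e) - τ₀) := mul_pos (by linarith) (by linarith)
        have e3 : L a b o τ₀ - lam * τ₀ = L a b e τ₀ - lam * τ₀ := by rw [hy]
        linarith
    · -- steeper than the ceiling: no point is weakly correct for `e, o, t`
      obtain ⟨θ', y', c1, c2, -, c4⟩ := hwit
      have c4' := c4 hto
      have hθ : τ₀ ≤ θ' := by rw [hτ₀']; exact (L_le_L_iff_crossAbs_le a b hs θ').mp (c2.trans c1)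
      have f1 := L_eq_L_add_mul a b e τ₀ θ'
      have f3 := L_eq_L_add_mul a b t τ₀ θ'
      nlinarith [mul_nonneg (sub_nonneg.mpr hgt'.le) (sub_nonneg.mpr hθ)]

/-- type III step: at the vertex of a floor `o` of slope `< λ` and a flatter ceiling `e` (a right tip), if every λ-type pair among `t, e, o` has
functional value at most that of `(e, o)` and some point is weakly correct for `e, o, t`, then `t` is not strictly incorrect at the vertex. [folklore] -/
theorem noBad_typeIII
    (hS : ∀ p q, S p q ↔
      ((¬ Even p ∧ ¬ Even q ∧ ((a p < lam ∧ lam < a q) ∨ (a q < lam ∧ lam < a p))) ∨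
       (Odd (p + q) ∧ (if Even p then a q < a p else a p < a q) ∧ lam < (if Even p then a q else a p)) ∨
       (Odd (p + q) ∧ (if Even p then a p < a q else a q < a p) ∧ (if Even p then a q else a p) < lam)))
    {e o t : ℕ} (he : Even e) (ho : ¬ Even o) (hs : a e < a o) (hl : a o < lam)
    (hAte : a t ≠ a e) (hAto : a t ≠ a o) (hlt : a t ≠ lam)
    (hbad : (Even t ∧ L a b t ((b o - b e) / (a e - a o)) < L a b o ((b o - b e) / (a e - a o))) ∨
      (¬ Even t ∧ L a b o ((b o - b e) / (a e - a o)) < L a b t ((b o - b e) / (a e - a o))))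
    (hmax : ∀ x y, (x = t ∨ x = e ∨ x = o) → (y = t ∨ y = e ∨ y = o) → S x y →
      L a b x ((b y - b x) / (a x - a y)) - lam * ((b y - b x) / (a x - a y)) ≤
        L a b o ((b o - b e) / (a e - a o)) - lam * ((b o - b e) / (a e - a o)))
    (hwit : ∃ θ' y', y' ≤ L a b e θ' ∧ L a b o θ' ≤ y' ∧ (Even t → y' ≤ L a b t θ') ∧ (¬ Even t → L a b t θ' ≤ y')) :
    False := by
  set τ₀ := (b o - b e) / (a e - a o) with hτ₀
  have hA : a e ≠ a o := ne_of_lt hs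
  have hy : L a b o τ₀ = L a b e τ₀ := L_eq_L_crossAbs a b hA
  rcases hbad with ⟨hte, hb⟩ | ⟨hto, hb⟩
  · -- a ceiling below the vertex
    rcases lt_or_gt_of_ne hAto with hlt' | hgt'
    · -- flatter than the floor: the right tip `(t, o)` is a better candidate
      have hSt : S t o := (hS t o).mpr (Or.inr (Or.inr ⟨by
        rw [Nat.odd_add']; exact ⟨fun _ => hte, fun _ => Nat.not_even_iff_odd.mp ho⟩,
        by rw [if_pos hte]; exact hlt', by rw [if_pos hte]; exact hl⟩))
      have hm := hmax t o (Or.inl rfl) (Or.inr (Or.inr rfl)) hSt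
      have hcr : (b o - b t) / (a t - a o) < τ₀ := (L_lt_L_iff_crossAbs_lt a b hlt' τ₀).mp hb
      have e1 : L a b t ((b o - b t) / (a t - a o)) = L a b o ((b o - b t) / (a t - a o)) :=
        (L_eq_L_crossAbs a b (ne_of_lt hlt')).symm
      rw [e1] at hm
      have e2 := phi_along a b lam o τ₀ ((b o - b t) / (a t - a o))
      have : 0 < (a o - lam) * ((b o - b t) / (a t - a o) - τ₀) := mul_pos_of_neg_of_neg (by linarith) (by linarith)
      linarith
    · -- steeper than the floor: no point is weakly correct for `e, o, t`
      obtain ⟨θ', y', c1, c2, c3, -⟩ := hwit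
      have c3' := c3 hte
      have hθ : θ' ≤ τ₀ := by rw [hτ₀]; exact (L_le_L_iff_le_crossAbs a b hs θ').mp (c2.trans c1)
      have f2 := L_eq_L_add_mul a b o τ₀ θ'
      have f3 := L_eq_L_add_mul a b t τ₀ θ'
      nlinarith [mul_nonneg_of_nonpos_of_nonpos (sub_nonpos.mpr hgt'.le) (sub_nonpos.mpr hθ)]
  · -- a floor above the vertex
    rcases lt_or_gt_of_ne hAte with hlt' | hgt'
    · -- flatter than the ceiling: no point is weakly correct for `e, o, t`
      obtain ⟨θ', y', c1, c2, -, c4⟩ := hwit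
      have c4' := c4 hto
      have hθ : θ' ≤ τ₀ := by rw [hτ₀]; exact (L_le_L_iff_le_crossAbs a b hs θ').mp (c2.trans c1)
      have f1 := L_eq_L_add_mul a b e τ₀ θ'
      have f3 := L_eq_L_add_mul a b t τ₀ θ'
      nlinarith [mul_nonneg_of_nonpos_of_nonpos (sub_nonpos.mpr hlt'.le) (sub_nonpos.mpr hθ)]
    · rcases lt_or_gt_of_ne hlt with hl' | hg'
      · -- slope between the ceiling's and `λ`: the right tip `(e, t)` is a better candidate
        have hSt : S e t := (hS e t).mpr (Or.inr (Or.inr ⟨by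
          rw [Nat.odd_add]; exact ⟨fun h => absurd he (Nat.not_even_iff_odd.mpr h), fun h => absurd h hto⟩,
          by rw [if_pos he]; exact hgt', by rw [if_pos he]; exact hl'⟩))
        have hm := hmax e t (Or.inr (Or.inl rfl)) (Or.inl rfl) hSt
        have hcr : (b t - b e) / (a e - a t) < τ₀ := (L_lt_L_iff_crossAbs_lt a b hgt' τ₀).mp (by rw [← hy]; exact hb)
        have e2 := phi_along a b lam e τ₀ ((b t - b e) / (a e - a t))
        have : 0 < (a e - lam) * ((b t - b e) / (a e - a t) - τ₀) :=
          mul_pos_of_neg_of_neg (by linarith) (by linarith)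
        have e3 : L a b o τ₀ - lam * τ₀ = L a b e τ₀ - lam * τ₀ := by rw [hy]
        linarith
      · -- steeper than `λ`: the bottom corner `(o, t)` is a better candidate
        have hSt : S o t := (hS o t).mpr (Or.inl ⟨ho, hto, Or.inl ⟨hl, hg'⟩⟩)
        have hm := hmax o t (Or.inr (Or.inr rfl)) (Or.inl rfl) hSt
        have hot' : a o < a t := hl.trans hg'
        have hcr : (b t - b o) / (a o - a t) < τ₀ := (L_lt_L_iff_crossAbs_lt a b hot' τ₀).mp hb
        have e2 := phi_along a b lam o τ₀ ((b t - b o) / (a o - a t))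
        have : 0 < (a o - lam) * ((b t - b o) / (a o - a t) - τ₀) := mul_pos_of_neg_of_neg (by linarith) (by linarith)
        linarith

end LowTips

end

end StaticPathFold

end Summit.ValiantsHypothesis.ValiantsHypothesis.Theorems.KPlusLogSqLaw
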